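import Literature.NumberTheory.Transcendental.CountableAmbientField
import Literature.NumberTheory.Transcendental.ExpVarietiesDimension
import HarnessLib

/-!
# Generic points of varieties over finitely generated fields of definition, inside the
ambient field

Seventh file of the elementary construction of the countable model of Zilber's axioms (towards
`exists_isZilberField_of_aleph0_lt`; B. Zilber, Ann. Pure Appl. Logic 132 (2005) §§3–5). The
step realising strong exponential-algebraic closedness adjoins a *generic point* of a variety
`W` over the current finitely generated field; this file supplies such points inside an ambient
field `Ω` with ambient data `A` (`CountableAmbientField.lean`: infinite transcendence degree
over every finite set, `A.gen`):

* `algebraicIndependent_defField_of_gen` — the tuples supplied by `A.gen S` are algebraically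
  independent over the field of definition `E = acl ℚ(S)` of the finite set `S`
  (`WeakZPTransfer.defField`, the relative algebraic closure of `ℚ(S)` in `Ω`);
* `exists_algHom_of_isTranscendenceBasis` — Steinitz: a field `L` algebraic over `E(b)`, `b` a
  finite transcendence basis, embeds into the algebraically closed `Ω` over `E` as soon as `Ω`
  contains a tuple algebraically independent over `E` of the same length;
* `exists_isGenericPt_defField` — consequently every prime ideal `P` of
  `E[X_{n ⊕ n}]` has a generic point in `Ω`: a point `z ∈ Ω^{n ⊕ n}` with `I(z/E) = P`
  (`IsGenericPt`, `ExpVarietiesDimension.lean`) — embed the function field of `P` over `E`.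

Everything is proved.

## References

* B. Zilber, *Pseudo-exponentiation on algebraically closed fields of characteristic zero*,
  Ann. Pure Appl. Logic 132 (2005), §3 (generic points of varieties over finitely generated
  fields).
-/

noncomputable section

open Set Matroid

namespace Literature.NumberTheory.Transcendental

namespace AmbientData

open GammaField WeakZPTransfer

variable {Ω : Type*} [Field Ω] [CharZero Ω] (A : AmbientData Ω)

/-! ### Algebraic independence over the field of definition of a finite set -/

include A in
/-- **The genericity supply over the field of definition**: for a finite `S ⊆ Ω` and every `m`
there is a tuple `u : Fin m → Ω` algebraically independent over `E = acl ℚ(S)`, the relative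
algebraic closure of `ℚ(S)` in `Ω` (a basis `B` of `S` in the algebraic matroid together with
`u` is algebraically independent over `ℚ`, so `u` is independent over `ℚ[B]`, over which `E`
is algebraic). [folklore] -/
theorem algebraicIndependent_defField_of_gen (S : Finset Ω) (m : ℕ) :
    ∃ u : Fin m → Ω, AlgebraicIndependent (defField ℚ (S : Set Ω)) u := by
  classical
  obtain ⟨u, hinj, hu⟩ := A.gen S m
  set M := AlgebraicIndependent.matroid ℚ Ω with hM
  obtain ⟨B, hB⟩ := M.exists_isBasis (S : Set Ω)
  obtain ⟨hIB, hSI⟩ := hB.contract_indep_iff.1 hu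
  have hBS : B ⊆ (S : Set Ω) := hB.subset
  have hdisj : Disjoint (range u) B := Disjoint.mono_right hBS hSI.symm
  -- `u ∪ B` algebraically independent over `ℚ`
  have hinj' : Function.Injective (Sum.elim u ((↑) : B → Ω)) := by
    rintro (a | a) (b | b) hab
    · exact congrArg Sum.inl (hinj hab)
    · exact (Set.disjoint_left.1 hdisj ⟨a, rfl⟩ ((show u a = b from hab) ▸ b.2)).elim
    · exact (Set.disjoint_left.1 hdisj ⟨b, rfl⟩ ((show (a : Ω) = u b from hab) ▸ a.2)).elim
    · exact congrArg Sum.inr (Subtype.ext hab)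
  have hsum : AlgebraicIndependent ℚ (Sum.elim u ((↑) : B → Ω)) := by
    have hind : AlgebraicIndepOn ℚ id (range u ∪ B) := AlgebraicIndependent.matroid_indep_iff.1 hIB
    refine (algebraicIndependent_subtype_range hinj').1 ?_
    rw [Sum.elim_range, Subtype.range_coe]
    exact hind
  set R := Algebra.adjoin ℚ (range ((↑) : B → Ω)) with hR
  have hu' : AlgebraicIndependent R u := (AlgebraicIndependent.sumElim_iff.1 hsum).2
  -- `E` is algebraic over `ℚ[B]`
  set E : IntermediateField ℚ Ω := defField ℚ (S : Set Ω) with hE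
  have hRE : R ≤ E.toSubalgebra := by
    rw [hR, Subtype.range_coe]
    exact Algebra.adjoin_le fun b hb => subset_defField (hBS hb)
  letI : Algebra R E := (Subalgebra.inclusion hRE).toRingHom.toAlgebra
  haveI : IsScalarTower R E Ω := IsScalarTower.of_algebraMap_eq fun _ => rfl
  haveI : Algebra.IsAlgebraic R E := by
    refine ⟨fun y => ?_⟩
    rw [← isAlgebraic_algebraMap_iff (algebraMap E Ω).injective]
    -- `y ∈ E ⊆ acl S = acl B`
    have hy : (y : Ω) ∈ acl B := by
      have h1 : (y : Ω) ∈ acl ((S : Set Ω)) :=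
        mem_acl_iff.2 ((IntermediateField.isAlgebraic_adjoin_iff).1 (mem_defField_iff.1 y.2))
      change (y : Ω) ∈ M.closure B
      rw [hB.closure_eq_closure]
      exact h1
    rw [mem_acl_iff] at hy
    rw [hR, Subtype.range_coe]
    exact hy
  exact ⟨u, hu'.extendScalars E⟩

/-! ### Steinitz: embedding a field of finite transcendence degree into `Ω` -/

omit [CharZero Ω] in
/-- **Extension of embeddings** (Steinitz): if the field `L` is algebraic over `K(b)` for a
finite algebraically independent family `b` (in some field `F'` acting on `L` through
`K(b) → L`), and `w` is a family of the same length in an algebraically closed field `Ω`,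
algebraically independent over `K ⊆ Ω`, then `L` embeds into `Ω` over `K` (send `b ↦ w`,
`K(b) ≅ Frac K[X] → Ω`, and lift along the algebraic extension `L/K(b)`). [folklore] -/
theorem exists_algHom_of_isTranscendenceBasis {K : Type*} [Field K] [Algebra K Ω] [IsAlgClosed Ω]
    {F' : Type*} [Field F'] [Algebra K F'] {m : ℕ} {b : Fin m → F'} (hb : AlgebraicIndependent K b)
    (L : Type*) [Field L] [Algebra K L]
    [Algebra (IntermediateField.adjoin K (Set.range b)) L]
    [IsScalarTower K (IntermediateField.adjoin K (Set.range b)) L]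
    [Algebra.IsAlgebraic (IntermediateField.adjoin K (Set.range b)) L]
    {w : Fin m → Ω} (hw : AlgebraicIndependent K w) :
    Nonempty (L →ₐ[K] Ω) := by
  have hwinj : Function.Injective (MvPolynomial.aeval w : MvPolynomial (Fin m) K →ₐ[K] Ω) :=
    (algebraicIndependent_iff_injective_aeval).1 hw
  let ψ₁' : FractionRing (MvPolynomial (Fin m) K) →ₐ[K] Ω := IsFractionRing.liftAlgHom hwinj
  let ψ₁ : IntermediateField.adjoin K (Set.range b) →ₐ[K] Ω :=
    ψ₁'.comp (hb.aevalEquivField.symm :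
      IntermediateField.adjoin K (Set.range b) →ₐ[K] FractionRing (MvPolynomial (Fin m) K))
  letI : Algebra (IntermediateField.adjoin K (Set.range b)) Ω := ψ₁.toRingHom.toAlgebra
  let τ' : L →ₐ[IntermediateField.adjoin K (Set.range b)] Ω := IsAlgClosed.lift
  refine ⟨{ τ'.toRingHom with commutes' := fun a => ?_ }⟩
  have h1 : algebraMap K L a = algebraMap (IntermediateField.adjoin K (Set.range b)) L
      (algebraMap K (IntermediateField.adjoin K (Set.range b)) a) :=
    IsScalarTower.algebraMap_apply _ _ _ a
  change τ' (algebraMap K L a) = algebraMap K Ω a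
  rw [h1, τ'.commutes]
  change ψ₁ (algebraMap K (IntermediateField.adjoin K (Set.range b)) a) = algebraMap K Ω a
  rw [ψ₁.commutes]

/-! ### Generic points over the field of definition of a finite set -/

section GenericPoint

variable [IsAlgClosed Ω] (S : Finset Ω) {n : ℕ}

/-- The function field of a prime `P` over a field `E` is generated, as a field over `E`, by the
coordinates of the generic point. [folklore] -/
theorem adjoin_range_genericPt_eq_top {E : Type*} [Field E]
    (P : Ideal (MvPolynomial (Fin n ⊕ Fin n) E)) [P.IsPrime] :
    IntermediateField.adjoin E (Set.range (genericPt P)) = ⊤ := by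
  rw [eq_top_iff]
  intro z _
  haveI : IsDomain (zeroLocusCoordRing P) := Ideal.Quotient.isDomain P
  -- `z = a / b` with `a, b` in the coordinate ring
  obtain ⟨a, b, hb, rfl⟩ := IsFractionRing.div_surjective (A := zeroLocusCoordRing P) z
  have hmem : ∀ c : zeroLocusCoordRing P,
      algebraMap (zeroLocusCoordRing P) (zeroLocusFunctionField P) c ∈
        IntermediateField.adjoin E (Set.range (genericPt P)) := by
    intro c
    obtain ⟨q, rfl⟩ := Ideal.Quotient.mk_surjective c
    rw [← aeval_genericPt]
    have hq : MvPolynomial.aeval (genericPt P) q ∈ Algebra.adjoin E (Set.range (genericPt P)) := by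
      rw [Algebra.adjoin_range_eq_range_aeval]; exact ⟨q, rfl⟩
    exact IntermediateField.algebra_adjoin_le_adjoin E _ hq
  exact div_mem (hmem a) (hmem b)

include A in
set_option maxHeartbeats 800000 in
set_option synthInstance.maxHeartbeats 200000 in
/-- **Generic points over the field of definition of a finite set exist in the ambient field**:
for a finite `S ⊆ Ω`, `E = acl ℚ(S)` its field of definition and a prime ideal `P` of
`E[X_{n ⊕ n}]`, there is `z ∈ Ω^{n ⊕ n}` with `I(z/E) = P` — the image of the generic point
under an embedding over `E` of the function field of `P` into `Ω`, which exists because `Ω`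
has infinite transcendence degree over `E` (`A.gen`) and is algebraically closed.
[cite: Zilber2005, §3] -/
theorem exists_isGenericPt_defField
    (P : Ideal (MvPolynomial (Fin n ⊕ Fin n) (defField ℚ (S : Set Ω)))) [hP : P.IsPrime] :
    ∃ z : Fin n ⊕ Fin n → Ω, IsGenericPt P z := by
  classical
  let E : IntermediateField ℚ Ω := defField ℚ (S : Set Ω)
  haveI : IsDomain (zeroLocusCoordRing P) := Ideal.Quotient.isDomain P
  haveI : FaithfulSMul E (zeroLocusCoordRing P) :=
    (faithfulSMul_iff_algebraMap_injective E (zeroLocusCoordRing P)).mpr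
      (algebraMap E (zeroLocusCoordRing P)).injective
  -- a transcendence basis of the coordinate ring among the coordinate functions
  set xB : Fin n ⊕ Fin n → zeroLocusCoordRing P := fun i => Ideal.Quotient.mk P (MvPolynomial.X i)
    with hxB
  have hadj : Algebra.adjoin E (Set.range xB) = ⊤ := by
    have h1 : Algebra.adjoin E (Set.range xB) =
        (Algebra.adjoin E (Set.range (MvPolynomial.X : Fin n ⊕ Fin n → MvPolynomial _ E))).map
          (Ideal.Quotient.mkₐ E P) := by
      rw [AlgHom.map_adjoin, ← Set.range_comp]; rfl
    rw [h1, MvPolynomial.adjoin_range_X, Algebra.map_top,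
      (AlgHom.range_eq_top _).2 (Ideal.Quotient.mkₐ_surjective E P)]
  haveI : Algebra.IsAlgebraic (Algebra.adjoin E (Set.range xB)) (zeroLocusCoordRing P) :=
    ⟨fun c => by
      have hc : c ∈ Algebra.adjoin E (Set.range xB) := by rw [hadj]; exact Algebra.mem_top
      exact isAlgebraic_algebraMap (⟨c, hc⟩ : Algebra.adjoin E (Set.range xB))⟩
  obtain ⟨t, hts, ht⟩ := exists_isTranscendenceBasis_subset (R := E) (A := zeroLocusCoordRing P)
    (Set.range xB)
  have htfin : t.Finite := (Set.finite_range xB).subset hts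
  obtain ⟨m, f, hf⟩ := htfin.fin_embedding
  -- as a basis of the function field
  haveI : Algebra.IsAlgebraic (zeroLocusCoordRing P) (zeroLocusFunctionField P) :=
    IsLocalization.isAlgebraic (zeroLocusFunctionField P) (nonZeroDivisors (zeroLocusCoordRing P))
  have ht' := ht.algebraMap_comp (A := zeroLocusFunctionField P)
  set b : Fin m → zeroLocusFunctionField P :=
    fun i => algebraMap (zeroLocusCoordRing P) (zeroLocusFunctionField P) (f i) with hb
  have hbt : IsTranscendenceBasis E b := by
    -- reindex `t` by `Fin m` through `f`
    let e : Fin m ≃ t := Equiv.ofBijective (fun i => ⟨f i, hf ▸ ⟨i, rfl⟩⟩)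
      ⟨fun i j hij => f.injective (Subtype.ext_iff.1 hij), fun ⟨y, hy⟩ => by
        rw [← hf] at hy; obtain ⟨i, rfl⟩ := hy; exact ⟨i, rfl⟩⟩
    have : b = (algebraMap (zeroLocusCoordRing P) (zeroLocusFunctionField P) ∘
        ((↑) : t → zeroLocusCoordRing P)) ∘ e := by
      funext i; rfl
    rw [this]
    exact ht'.comp_equiv e
  -- `L` is algebraic over `E(b)`
  haveI : Algebra.IsAlgebraic (IntermediateField.adjoin E (Set.range b))
      (zeroLocusFunctionField P) := hbt.isAlgebraic_field
  -- an algebraically independent `w` of the same length in `Ω`, and the embedding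
  obtain ⟨w, hw⟩ := A.algebraicIndependent_defField_of_gen S m
  obtain ⟨τ⟩ := exists_algHom_of_isTranscendenceBasis (K := E) hbt.1 (zeroLocusFunctionField P) hw
  exact ⟨τ ∘ genericPt P, IsGenericPt.map P (isGenericPt_genericPt P) τ τ.toRingHom.injective⟩

end GenericPoint

end AmbientData

end Literature.NumberTheory.Transcendental

end
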